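import Literature.NumberTheory.Rogawski1990.EndoscopicStableTwistAutomorphism   -- ★ F0P3a-p09 (g11) brings ★ `RankOneTorusStablePartner` (`formCongr_diagonal_antidiagTwo`, `isLocalStablyConjH_partnerCongr_not_isConj`), ★ `LocalStableClassesRankTwoCompactSideCount` (trichotomy, two classes, split∕irreducible one class), ★ `isGRegular_of_isStablyConjH`
import Literature.NumberTheory.Automorphic.LocalStableConjSplitPlace              -- ★ `isConj_of_isStablyConj_of_split` (at a split place stable conjugacy is conjugacy)
import Literature.NumberTheory.Automorphic.QuadraticHeckeCharacterCM              -- ★ `cmQuadraticGenerator_spec`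
import Literature.NumberTheory.Automorphic.QuadraticLocalBaseChange               -- ★ instance `PlacesOver.nonempty`
import Summits.HodgeConjecture.HodgeConjecture.Theorems.R90S4SimilConjEquivalence -- ★ p861479 `cmDatumLocalCongr_one_eq_refl`
import Literature.Topology.RestrictedProductProdEquiv                            -- ★ `Literature.Topology.ContinuousMulEquiv.prodCongr`
import HarnessLib

/-!
# R90-TF · S4 (Rogawski Ch. 13.1–2) — letter (H2) of the S4#B6 road «restriction ∕ similitude» PAID: a `G`-regular stable class of
# `H_v = U(Φ₂)_v × U(Φ₁)_v` is `{[γ], [E_T γ]}` for ONE similitude `T` of record (𝔇(T∕F) has order ≤ 2, [LL])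

Cell `hodgecm-mathlib`, crux H413 (`stmt-HodgeConjecture-24833`, lane `--supports … --as helper`), route of record `HCCMUnconditional`
(count-neutral).  Programme R90-TF, section S4 (dealer K2E2-plan (g6)); seat K2E3-p11 (g8); pays letter (H2) `hST` of ★ p861950
`Theorems/R90S4HPacketStable.lean` (`isStableFinsetH_of_isRogPacketH`), as an EXISTENTIAL over the similitude datum `(T, a, ha, hT)`:
`∃ T a ha hT, ∀ γ G-regular, ∀ c, IsLocalStablyConjH L v γ c.out ↔ (c = ⟦γ⟧ ∨ c = ⟦E_T γ⟧)`, `E_T := Ad(T) × id` (★ `cmDatumLocalCongr`,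
★ `ContinuousMulEquiv.prodCongr`).

THE MATHEMATICS (Rogawski §3.1 p. 19: the classes inside a stable class are parametrised by `𝔇(T∕F) = ker(H¹(F,T) → H¹(F,G))`; §3.6 pp. 31–32
for `U(1,1) × U(1)`: order `2` on the compact Cartan `E¹ × E¹`, order `1` otherwise; [LL] §2).  In the tree's cohomology-free currency (★ F0P3a-p09's
`EndoscopicStableTwistAutomorphism`, whose CLAUSES are existential in `e` — here re-run for the EXPLICIT similitude so that the packet side of the
road, which needs `E_T = Ad(T) × id` on the nose, can consume it):
* NON-SPLIT `v` (§1): `T_r = diag(1, r)` for a `σ`-fixed NON-NORM unit `r` (★ `exists_conjLocal_eq_not_exists_norm`) is a similitude of `Φ₂` with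
  multiplier `r` (★ `formCongr_diagonal_antidiagTwo`); `E_{T_r} γ` is stably conjugate to `γ`; by the trichotomy of a `G`-regular `γ.1` (★
  `eigenframe_trichotomy_of_separable`) the stable class of `γ` is two classes in eigenframe type (★ `exists_twoClasses_of_eigenframe`, and
  `E_{T_r} γ` is NOT conjugate to `γ` there, ★ `isLocalStablyConjH_partnerCongr_not_isConj`) and one class otherwise (★
  `isConj_of_isLocalStablyConjH_of_split` ∕ `…_of_not_exists_isRoot`); hence `{c | γ ∼_st c.out} = {⟦γ⟧, ⟦E_{T_r} γ⟧}` (★ `setOf_st_out_eq_pair`).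
* SPLIT `v` (§2): stable conjugacy IS conjugacy on both factors (★ `isConj_of_isStablyConj_of_split`), so the stable class is `{⟦γ⟧}` and the
  similitude of record is `T = 1` (`E_1 = id`, ★ `cmDatumLocalCongr_one_eq_refl`).
* §3 the existential (H2), by the split ∕ non-split dichotomy of a place `w ∣ v` (★ `PlacesOver.nonempty`).

HONEST LABEL: a letter of a CONDITIONAL reduction paid; the socket `stub_R90_S4_H_stable` stays OPEN modulo (H1) (H4) (H5); HC_CM is proved only
modulo the 7 printed citations (2 remaining named inputs: hLiu418 = stmt-HodgeConjecture-24832, h413 = stmt-HodgeConjecture-24833) until rung 0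
closes; REL ≠ ★ ≠ BUILT; count-neutral.

## References
* [Rogawski1990] J. D. Rogawski, *Automorphic Representations of Unitary Groups in Three Variables*, Ann. of Math. Stud. 123 (1990), §3.1 p. 19,
  §3.5 Prop. 3.5.2 (c) p. 29, §3.6 pp. 31–32, §4.3 p. 42, §11.1 p. 161, §11.5 p. 167, §14.2 p. 232.
* [LabesseLanglands1979] J.-P. Labesse, R. P. Langlands, *L-indistinguishability for SL(2)*, Canad. J. Math. 31 (1979), §2.
* [PlatonovRapinchuk1994] V. Platonov, A. Rapinchuk, *Algebraic Groups and Number Theory* (1994), §2.3.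
-/

set_option autoImplicit false
set_option linter.dupNamespace false

noncomputable section

open NumberField IsDedekindDomain Matrix
open scoped MatrixGroups
open Literature.NumberTheory.Automorphic Literature.NumberTheory.Automorphic.UnitaryGroup
open Literature.NumberTheory.Rogawski1990
open Literature.AlgebraicGeometry.ShimuraVarieties (unitaryGroup mem_unitaryGroup_iff)

namespace Summit.HodgeConjecture.HodgeConjecture.R90.S4

section CM

variable (L : Type) [Field L] [NumberField L] [IsCMField L] (v : HeightOneSpectrum (𝓞 ↥(maximalRealSubfield L)))

/-! ## §1 Non-split `v`: the explicit similitude `T_r = diag(1, r)` and the pair of classes -/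

section Nonsplit

variable {L v}
variable (w : PlacesOver L v) (hw : IsCMField.complexConj L • w.1 = w.1) {r : LocalRing L v} (hru : IsUnit r)
  (hrσ : conjLocal L (IsCMField.complexConj L) v r = r)

/-- `E_{T_r} a` is stably conjugate to `a` (`T_r ∈ GL₂(L ⊗ L⁺_v)` is a stable conjugator; the `U(Φ₁)`-components agree).
[cite: Rogawski1990, §3.1 p. 19; §3.6 pp. 31–32] -/
theorem isLocalStablyConjH_prodCongr_diag (a : ((cmDatum L 2 (Matrix.of fun i j : Fin 2 => if i.val + j.val + 1 = 2 then (1 : L) else 0)).Local v ×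
      (cmDatum L 1 (Matrix.of fun i j : Fin 1 => if i.val + j.val + 1 = 1 then (1 : L) else 0)).Local v)) :
    IsLocalStablyConjH L v a
      (Literature.Topology.ContinuousMulEquiv.prodCongr
        (cmDatumLocalCongr L v (glDiagonal 2 (LocalRing L v) ![1, hru.unit]) hru (formCongr_diagonal_antidiagTwo L v hru hrσ))
        (ContinuousMulEquiv.refl ((cmDatum L 1 (Matrix.of fun i j : Fin 1 => if i.val + j.val + 1 = 1 then (1 : L) else 0)).Local v)) a) := by
  show IsStablyConj _ _ _ _ ∧ IsStablyConj _ _ _ _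
  exact ⟨isStablyConj_iff.2 ⟨_, (coe_cmDatumLocalCongr_apply L v _ hru (formCongr_diagonal_antidiagTwo L v hru hrσ) a.1).symm⟩,
    IsStablyConj.refl _⟩

include hw in
/-- **Exhaustion at a non-split place**: for a `σ`-fixed NON-NORM unit `r`, every stable conjugate of a `G`-regular `a` is conjugate to `a` or to
`E_{T_r} a` (trichotomy ★ `eigenframe_trichotomy_of_separable`; eigenframe type ★ `exists_twoClasses_of_eigenframe` with `E_{T_r} a ≁ a` ★
`isLocalStablyConjH_partnerCongr_not_isConj`; split ∕ irreducible type one class). [cite: Rogawski1990, §3.5 Prop. 3.5.2 (c) p. 29; §3.6 p. 31] -/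
theorem isConj_or_isConj_prodCongr_diag_of_isLocalStablyConjH
    (hrn : ¬ ∃ z : LocalRing L v, IsUnit z ∧ r = conjLocal L (IsCMField.complexConj L) v z * z)
    (a : ((cmDatum L 2 (Matrix.of fun i j : Fin 2 => if i.val + j.val + 1 = 2 then (1 : L) else 0)).Local v ×
      (cmDatum L 1 (Matrix.of fun i j : Fin 1 => if i.val + j.val + 1 = 1 then (1 : L) else 0)).Local v)) (ha : IsLocalGRegular L v a)
    (k : ((cmDatum L 2 (Matrix.of fun i j : Fin 2 => if i.val + j.val + 1 = 2 then (1 : L) else 0)).Local v ×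
      (cmDatum L 1 (Matrix.of fun i j : Fin 1 => if i.val + j.val + 1 = 1 then (1 : L) else 0)).Local v)) (hk : IsLocalStablyConjH L v a k) :
    IsConj a k ∨
      IsConj (Literature.Topology.ContinuousMulEquiv.prodCongr
        (cmDatumLocalCongr L v (glDiagonal 2 (LocalRing L v) ![1, hru.unit]) hru (formCongr_diagonal_antidiagTwo L v hru hrσ))
        (ContinuousMulEquiv.refl ((cmDatum L 1 (Matrix.of fun i j : Fin 1 => if i.val + j.val + 1 = 1 then (1 : L) else 0)).Local v)) a) k := by
  have hreg : IsRegularElt (a.1.val : GL (Fin 2) (LocalRing L v)) := (isRegularElt_fst_snd_of_isLocalGRegular L v a ha).1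
  have hsep : (a.1.val : GL (Fin 2) (LocalRing L v)).val.charpoly.Separable := hreg
  rcases eigenframe_trichotomy_of_separable L v w hw (isUnit_det_adelicForm_antidiagTwo_local L v) a.1.2 hsep with
    ⟨P, d, hP, hd, hd1⟩ | ⟨P, d, hP, -, h0⟩ | hroot
  · obtain ⟨a', -, -, hall⟩ := exists_twoClasses_of_eigenframe L v w hw a hP hd hd1
    rcases hall k hk with h | h
    · exact Or.inl h
    · rcases hall _ (isLocalStablyConjH_prodCongr_diag hru hrσ a) with h' | h'
      · exact absurd h' (isLocalStablyConjH_partnerCongr_not_isConj L v w hw hru hrσ hrn a P d hreg hP hd1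
          ⟨a, Subgroup.mem_centralizer_iff.2 fun b hb => by rw [Set.mem_singleton_iff.1 hb]⟩ hreg).2
      · exact Or.inr (h'.symm.trans h)
  · exact Or.inl (isConj_of_isLocalStablyConjH_of_split L v w hw a hP h0 k hk)
  · exact Or.inl (isConj_of_isLocalStablyConjH_of_not_exists_isRoot L v w hw a hroot k hk)

include hw in
/-- **Non-split `v`: the `G`-regular stable class of `a` is `{⟦a⟧, ⟦E_{T_r} a⟧}`** (★ `setOf_st_out_eq_pair`).
[cite: Rogawski1990, §3.5 Prop. 3.5.2 (c) p. 29; §3.6 pp. 31–32] [cite: LabesseLanglands1979, §2] -/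
theorem setOf_isLocalStablyConjH_out_eq_pair_of_nonsplit
    (hrn : ¬ ∃ z : LocalRing L v, IsUnit z ∧ r = conjLocal L (IsCMField.complexConj L) v z * z)
    (a : ((cmDatum L 2 (Matrix.of fun i j : Fin 2 => if i.val + j.val + 1 = 2 then (1 : L) else 0)).Local v ×
      (cmDatum L 1 (Matrix.of fun i j : Fin 1 => if i.val + j.val + 1 = 1 then (1 : L) else 0)).Local v)) (ha : IsLocalGRegular L v a) :
    {c : ConjClasses ((cmDatum L 2 (Matrix.of fun i j : Fin 2 => if i.val + j.val + 1 = 2 then (1 : L) else 0)).Local v ×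
        (cmDatum L 1 (Matrix.of fun i j : Fin 1 => if i.val + j.val + 1 = 1 then (1 : L) else 0)).Local v) |
      IsLocalStablyConjH L v a (Quotient.out c)} =
      {ConjClasses.mk a,
        ConjClasses.mk (Literature.Topology.ContinuousMulEquiv.prodCongr
          (cmDatumLocalCongr L v (glDiagonal 2 (LocalRing L v) ![1, hru.unit]) hru (formCongr_diagonal_antidiagTwo L v hru hrσ))
          (ContinuousMulEquiv.refl ((cmDatum L 1 (Matrix.of fun i j : Fin 1 => if i.val + j.val + 1 = 1 then (1 : L) else 0)).Local v)) a)} := by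
  have hrefl : ∀ b : ((cmDatum L 2 (Matrix.of fun i j : Fin 2 => if i.val + j.val + 1 = 2 then (1 : L) else 0)).Local v ×
      (cmDatum L 1 (Matrix.of fun i j : Fin 1 => if i.val + j.val + 1 = 1 then (1 : L) else 0)).Local v),
      IsConj a b → IsLocalStablyConjH L v a b := fun _ h => isStablyConjH_of_isConj h
  have hconj : ∀ (b y : ((cmDatum L 2 (Matrix.of fun i j : Fin 2 => if i.val + j.val + 1 = 2 then (1 : L) else 0)).Local v ×
      (cmDatum L 1 (Matrix.of fun i j : Fin 1 => if i.val + j.val + 1 = 1 then (1 : L) else 0)).Local v)),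
      IsLocalStablyConjH L v a b → IsLocalStablyConjH L v a (y * b * y⁻¹) :=
    fun b y hb => hb.trans (isStablyConjH_of_isConj (isConj_iff.2 ⟨y, rfl⟩))
  exact setOf_st_out_eq_pair (IsLocalStablyConjH L v) a _ hrefl hconj (isLocalStablyConjH_prodCongr_diag hru hrσ a)
    (isConj_or_isConj_prodCongr_diag_of_isLocalStablyConjH w hw hru hrσ hrn a ha)

end Nonsplit

/-! ## §2 Split `v`: the stable class is one class -/

/-- **Split `v`: the stable class of EVERY `a ∈ H_v` is `{⟦a⟧}`** (stable conjugacy is conjugacy on both factors at a split place, ★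
`isConj_of_isStablyConj_of_split`). [cite: Rogawski1990, §14.2 p. 232; §3.1 p. 19] -/
theorem setOf_isLocalStablyConjH_out_eq_singleton_of_split (w : PlacesOver L v) (hw : IsCMField.complexConj L • w.1 ≠ w.1)
    (a : ((cmDatum L 2 (Matrix.of fun i j : Fin 2 => if i.val + j.val + 1 = 2 then (1 : L) else 0)).Local v ×
      (cmDatum L 1 (Matrix.of fun i j : Fin 1 => if i.val + j.val + 1 = 1 then (1 : L) else 0)).Local v)) :
    {c : ConjClasses ((cmDatum L 2 (Matrix.of fun i j : Fin 2 => if i.val + j.val + 1 = 2 then (1 : L) else 0)).Local v ×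
        (cmDatum L 1 (Matrix.of fun i j : Fin 1 => if i.val + j.val + 1 = 1 then (1 : L) else 0)).Local v) |
      IsLocalStablyConjH L v a (Quotient.out c)} = {ConjClasses.mk a} := by
  ext c
  simp only [Set.mem_setOf_eq, Set.mem_singleton_iff]
  constructor
  · intro hst
    obtain ⟨x, hx⟩ := isConj_iff.1
      (isConj_of_isStablyConj_of_split L 2 _ (antidiagOne_isHermitian L 2) (isUnit_antidiagOne_det L 2).ne_zero w hw a.1 (Quotient.out c).1 hst.1)
    obtain ⟨y, hy⟩ := isConj_iff.1
      (isConj_of_isStablyConj_of_split L 1 _ (antidiagOne_isHermitian L 1) (isUnit_antidiagOne_det L 1).ne_zero w hw a.2 (Quotient.out c).2 hst.2)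
    have h1 : IsConj a (Quotient.out c) := isConj_iff.2 ⟨(x, y), Prod.ext hx hy⟩
    rw [ConjClasses.mk_eq_mk_iff_isConj.2 h1]
    exact (Quotient.out_eq c).symm
  · rintro rfl
    exact isStablyConjH_of_isConj (ConjClasses.mk_eq_mk_iff_isConj.1 (Quotient.out_eq (ConjClasses.mk a))).symm

/-! ## §3 LETTER (H2) PAID, as an existential over the similitude of record -/

/-- **LETTER (H2) of the S4#B6 road — a `G`-regular stable class of `H_v` is `{[γ], [E_T γ]}` for ONE similitude `T` of `Φ₂`.**
There are `T ∈ GL₂(L ⊗ L⁺_v)` and a unit `a` with `ᵗT̄ Φ₂ T = a Φ₂` such that, with `E_T := Ad(T) × id : H_v ≃ₜ* H_v`, for every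
`G`-regular `γ ∈ H_v` and every conjugacy class `c` of `H_v`: `γ` is stably conjugate to `c.out` iff `c = ⟦γ⟧` or `c = ⟦E_T γ⟧` — the
hypothesis `hST` of ★ `isStableFinsetH_of_isRogPacketH`, TOKEN FOR TOKEN.  At a non-split `v`, `T = diag(1, r)` with `r` a `σ`-fixed non-norm
(§1); at a split `v`, `T = 1` (§2). [cite: Rogawski1990, §3.1 p. 19; §3.6 pp. 31–32; §11.1 p. 161; §11.5 p. 167] [cite: LabesseLanglands1979, §2] -/
theorem exists_simil_forall_isLocalStablyConjH_out_iff :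
    ∃ (T : GL (Fin 2) (LocalRing L v)) (a : LocalRing L v) (ha : IsUnit a)
      (hT : formCongr (conjLocal L (IsCMField.complexConj L) v) T
          ((Matrix.of fun i j : Fin 2 => if i.val + j.val + 1 = 2 then (1 : L) else 0).map (algebraMap L (LocalRing L v))) =
        a • (Matrix.of fun i j : Fin 2 => if i.val + j.val + 1 = 2 then (1 : L) else 0).map (algebraMap L (LocalRing L v))),
      ∀ γ : (cmDatum L 2 (Matrix.of fun i j : Fin 2 => if i.val + j.val + 1 = 2 then (1 : L) else 0)).Local v ×
          (cmDatum L 1 (Matrix.of fun i j : Fin 1 => if i.val + j.val + 1 = 1 then (1 : L) else 0)).Local v,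
        IsLocalGRegular L v γ → ∀ c : ConjClasses ((cmDatum L 2 (Matrix.of fun i j : Fin 2 => if i.val + j.val + 1 = 2 then (1 : L) else 0)).Local v ×
          (cmDatum L 1 (Matrix.of fun i j : Fin 1 => if i.val + j.val + 1 = 1 then (1 : L) else 0)).Local v),
          IsLocalStablyConjH L v γ c.out ↔
            (c = ConjClasses.mk γ ∨
              c = ConjClasses.mk (Literature.Topology.ContinuousMulEquiv.prodCongr (cmDatumLocalCongr L v T ha hT)
                (ContinuousMulEquiv.refl ((cmDatum L 1 (Matrix.of fun i j : Fin 1 => if i.val + j.val + 1 = 1 then (1 : L) else 0)).Local v)) γ)) := by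
  classical
  obtain ⟨w⟩ := (inferInstance : Nonempty (PlacesOver L v))
  by_cases hw : IsCMField.complexConj L • w.1 = w.1
  · -- non-split: the similitude `T_r = diag(1, r)`, `r` a `σ`-fixed non-norm unit
    obtain ⟨αg, hα0, hcα, -⟩ := cmQuadraticGenerator_spec L
    obtain ⟨r, hrσ, hru, hrn⟩ := exists_conjLocal_eq_not_exists_norm L v (IsCMField.complexConj L) hcα hα0 w hw
    refine ⟨glDiagonal 2 (LocalRing L v) ![1, hru.unit], r, hru, formCongr_diagonal_antidiagTwo L v hru hrσ, fun γ hγ c => ?_⟩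
    have hset := setOf_isLocalStablyConjH_out_eq_pair_of_nonsplit w hw hru hrσ hrn γ hγ
    have hc := Set.ext_iff.1 hset c
    simpa only [Set.mem_setOf_eq, Set.mem_insert_iff, Set.mem_singleton_iff] using hc
  · -- split: `T = 1`, the stable class is one class
    have h1 : formCongr (conjLocal L (IsCMField.complexConj L) v) (1 : GL (Fin 2) (LocalRing L v))
        ((Matrix.of fun i j : Fin 2 => if i.val + j.val + 1 = 2 then (1 : L) else 0).map (algebraMap L (LocalRing L v))) =
        (1 : LocalRing L v) • (Matrix.of fun i j : Fin 2 => if i.val + j.val + 1 = 2 then (1 : L) else 0).map (algebraMap L (LocalRing L v)) := by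
      simp [formCongr, Matrix.map_one]
    refine ⟨1, 1, isUnit_one, h1, fun γ _ c => ?_⟩
    have hE : Literature.Topology.ContinuousMulEquiv.prodCongr (cmDatumLocalCongr L v 1 isUnit_one h1)
        (ContinuousMulEquiv.refl ((cmDatum L 1 (Matrix.of fun i j : Fin 1 => if i.val + j.val + 1 = 1 then (1 : L) else 0)).Local v)) γ = γ := by
      rw [Literature.Topology.ContinuousMulEquiv.prodCongr_apply, cmDatumLocalCongr_one_eq_refl]
      rfl
    rw [hE, or_self]
    have hset := setOf_isLocalStablyConjH_out_eq_singleton_of_split L v w hw γ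
    have hc := Set.ext_iff.1 hset c
    simpa only [Set.mem_setOf_eq, Set.mem_singleton_iff] using hc

end CM

end Summit.HodgeConjecture.HodgeConjecture.R90.S4

end
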